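import Literature.AnabelianGeometry.EtaleTheta.Thm56SubdagStatementsGalois
import Literature.AnabelianGeometry.EtaleTheta.Discharge.Sec5Prop55EtaTautological
import Literature.AnabelianGeometry.EtaleTheta.Discharge.Sec5UnitsCentralOfBiKummerData
import Literature.AnabelianGeometry.EtaleTheta.Discharge.Sec5LDeltaCovered
import Literature.AnabelianGeometry.EtaleTheta.Discharge.Sec5DeltaTransportCompat
import HarnessLib

/-!
# [EtTh] Prop. 5.5 / Thm. 5.6 (i): the four `P`-typed sub-DAG inputs AT THE ASSEMBLED §5 DATA `ofBiKummerData`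
# ON THE v2 SUBQUOTIENT RECORD `ThetaSubquotientProjGalois` (surjective at Galois objects only; proof-only)

S. Mochizuki, *The étale theta function and its Frobenioid-theoretic manifestations*, Publ. RIMS **45** (2009) [MochizukiEtTh2009],
Prop. 5.5 proof p.327 (PDF p.101) l.−3 – p.328 l.1 (the étale theta class «determines an isomorphism `(l·Δ_Θ)_{S″} ⊗ ℤ/Nℤ ⥲ μ_N(S″)`»),
Thm. 5.6 proof p.329 (PDF p.103) l.19–21 («the Kummer class of the "constant function" `u` does not affect the restriction … to
`(l·Δ_Θ)`»), §1 p.238 (PDF p.12) («`Δ_Θ` is a quotient of `Π^tp_Ÿ`») [cite: MochizukiEtTh2009, Prop 5.5 p.327 (PDF p.101)]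
[cite: MochizukiEtTh2009, Thm 5.6 p.328 (PDF p.102)].

abc-iut cell, layer L2, seat abc-iut-w5-d013 (gen 7); cone nodes EtTh:Prop5.5 / EtTh:Thm5.6(i); row «(w4-R) V1→V2 PORT OF THE PROP 5.5 /
THM 5.6 (i) ROOF CHAIN BY ITS AUTHOR» (sequel of abc-iut-w6-d079's (w4), GAP-LEDGER G-w4d042g3-1 plan (a)).  PROOF-ONLY (0 definitions;
nothing landed is edited or restated).  The carrier-level producers of the three `P`-typed sub-DAG inputs of the Prop. 5.5 / Thm. 5.6 (i)
assembly at abc-iut-L2-t4's assembled §5 data `𝔉 := ThetaFrobenioid.ofBiKummerData …` — abc-iut-w5-d123's `etaTautological_ofBiKummerData` /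
`exists_eta_etaTautological_ofBiKummerData` (P55-L02, `Sec5Prop55EtaTautological`), abc-iut-w5-d020's `unitsCentralUnderLDelta_ofBiKummerData` /
`cyclotomeCentralUnderLDelta_ofBiKummerData` (T56-L09b / P55-L02b, `Sec5UnitsCentralOfBiKummerData`) and abc-iut-w5-d123's
`lDeltaCovered_ofBiKummerData` (coverage, `Sec5LDeltaCovered`), and this lineage's T56-L09c producers `Thm56Sub.deltaTransportCompat_of` /
`pre_stable_of` / `deltaTransportCompat_ofBiKummerData` (`Sec5DeltaTransportCompat`) — bind abc-iut-L2-t4's v1 record `(P : ThetaSubquotientProj 𝔉)`, which asks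
`proj E` onto at EVERY base object and is EMPTY at the root-model stub for `l` odd (p476337).  Here the SAME proofs are re-run VERBATIM on
abc-iut-w6-d079's v2 record `(P : ThetaSubquotientProjGalois 𝔉 Gal)` (p481123; INHABITED at every level stub, p486065
`RigidData.nonempty_thetaSubquotientProjGalois_of_stub_eq_levelStub`), concluding the v2 twins `EtaTautologicalGal`, `UnitsCentralUnderLDeltaGal`,
`CyclotomeCentralUnderLDeltaGal`, `LDeltaCoveredGal`, `DeltaTransportCompatGal` (p484491); the `P`-free producers (`ThetaEnvData.exists_descent_thetaCocycle`,
`RigidData.cocycle_lDeltaTheta`, `sgpCapSection_ofBiKummerData`, `ModelFrobenioid.mul_units_comm_of_unit_fixed`, `RigidData.thetaMod_surjective`)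
are consumed BY NAME.  These feed the carrier heads of `Sec5RigidityOfBiKummerDataGalois` (sequel).

HONEST FRAMING: conditional producers — the row-2 laws `hlift`/`hpre`/`hP`, the coefficient identification `e`, `hdies`, `hσ`, `hgeom`,
`hconst` are HYPOTHESES (what the genuine instance supplies); nothing asserts that such data exist for an actual curve; [EtTh] is refereed
pre-IUT material; nothing here bears on [IUTchIII] Cor. 3.12 — no side is taken; typed ≠ proved.
-/

noncomputable section

namespace Literature.AnabelianGeometry.EtaleTheta

open CategoryTheory Opposite FrobenioidCyclotomicRigidity Literature.AlgebraicGeometry.Frobenioids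

universe u₀ v₀ u v w

namespace ThetaFrobenioid

section EtaAndCoverage

variable {K : Type u₀} [Field K]
  {X : SemiGraphs.TemperedArithmeticGroup.{u₀} K} {D₀ : Type u₀} [Category.{v₀} D₀]
  {V : FrdIMonoidStub.{w}} {T₀ : RealifiedDivisorMonoids (D₀ := D₀) V} {D : Type u} [Category.{v} D]
  {VD : FrdICatStub.{u, v, w} D} {S : BiKummerSetting X T₀ D VD}
  {pullFrac : ∀ {A A' : S.C} (_ : A' ⟶ A), S.biratUnits A → S.biratUnits A'}
  {lv N : ℕ+} {l' : ℕ} {RD : RigidData.{max v w} N l'} {θ : S.biratUnits S.Aodot} {Bl : S.C}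
  {Pl : S.FractionPair θ Bl} {Rl : S.NthRoot θ Pl lv pullFrac}
  (h : ModelFrobenioid.Hypotheses S.tf.divisorMonoid S.tf.ratFnFunctor)
  (toB : ∀ A : S.C, S.biratUnits A →* S.tf.biratUnitsModel A) (Q : FrobenioidTheta.ThetaSubquotientStub.{w} D)
  (odd_l : Odd (lv : ℕ)) (R : S.NthRoot Rl.root Rl.pair N pullFrac) (ιX : RD.PiX ≃ₜ* X.Pi)
  (hopen : IsOpen ((S.galoisSurj R.AN.base R.αData.isGalois).ker : Set X.Pi)) (σ : Aut R.AN.base →* Aut R.AN)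
  (K' : Type w) [Field K'] (constEmb : K'ˣ →* S.tf.biratUnitsModel R.BN)
  (constEmb_injective : Function.Injective constEmb)
  (hdivc : ∀ g : Aut R.BN.base,
    ModelFrobenioid.div ((σ ((BiKummerSetting.NthRoot.baseIso S R).conjAut.symm g)).hom ≫ R.pair.num) =
      ModelFrobenioid.div R.pair.num)
  (hdivp : ∀ y : RD.PiYdd,
    ModelFrobenioid.div ((σ (S.galoisSurj R.AN.base R.αData.isGalois (ιX y.1))).hom ≫ R.pair.den) =
      ModelFrobenioid.div R.pair.den)
  {Gal : D → Prop}

/-- (v2 record; abc-iut-w5-d123's `etaTautological_ofBiKummerData` VERBATIM.) **EtTh:Prop5.5/P55-L02 at the carrier**: for the §5 data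
`𝔉 := ofBiKummerData …` over a §2 `RigidData`, EVERY `η : H_{B_N} → (l·Δ_Θ)_{B_N} ⊗ ℤ/Nℤ` descending a mod-`N` theta cocycle `η₀` along
`ρ = rhoOfBiKummerData R ιX` through `e` (`hη`) is TAUTOLOGICAL on the part of `H_{B_N}` over `(l·Δ_Θ)_{B_N}` (v2 `EtaTautologicalGal 𝔉 P η`)
for every v2 subquotient datum `P` satisfying the row-2 laws `hlift`, `hP` (`RigidData.cocycle_lDeltaTheta`, Prop. 1.3 / 1.5 (iii)).
[cite: MochizukiEtTh2009, Prop 5.5 proof p.327 (PDF p.101)] -/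
theorem etaTautological_ofBiKummerData_galois
    {η₀ : RD.PiYdd → RD.mu} (hη₀ : η₀ ∈ RD.thetaCocycles)
    (e : RD.mu → (ofBiKummerData h toB Q odd_l R ιX hopen σ K' constEmb constEmb_injective hdivc hdivp).lDeltaModN
      (ofBiKummerData h toB Q odd_l R ιX hopen σ K' constEmb constEmb_injective hdivc hdivp).BN)
    (η : (ofBiKummerData h toB Q odd_l R ιX hopen σ K' constEmb constEmb_injective hdivc hdivp).HB →
      (ofBiKummerData h toB Q odd_l R ιX hopen σ K' constEmb constEmb_injective hdivc hdivp).lDeltaModN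
        (ofBiKummerData h toB Q odd_l R ιX hopen σ K' constEmb constEmb_injective hdivc hdivp).BN)
    (hη : ∀ k : RD.PiYdd, η ⟨rhoOfBiKummerData R ιX k, Subgroup.mem_map_of_mem _ k.2⟩ = e (η₀ k))
    (P : ThetaSubquotientProjGalois
      (ofBiKummerData h toB Q odd_l R ιX hopen σ K' constEmb constEmb_injective hdivc hdivp) Gal)
    (hlift : ∀ a ∈ (ofBiKummerData h toB Q odd_l R ιX hopen σ K' constEmb constEmb_injective hdivc hdivp).HB,
      a ∈ P.pre _ → ∃ k : RD.PiYdd, (k : RD.PiX) ∈ RD.lDeltaTheta ∧ rhoOfBiKummerData R ιX k = a)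
    (hP : ∀ (k : RD.PiYdd) (hk : (k : RD.PiX) ∈ RD.lDeltaTheta) (hm : rhoOfBiKummerData R ιX k ∈ P.pre _),
      (QuotientGroup.mk (P.proj _ ⟨rhoOfBiKummerData R ιX k, hm⟩) :
          (ofBiKummerData h toB Q odd_l R ιX hopen σ K' constEmb constEmb_injective hdivc hdivp).lDeltaModN
            (ofBiKummerData h toB Q odd_l R ιX hopen σ K' constEmb constEmb_injective hdivc hdivp).BN) =
        e (RD.thetaMod ⟨k, hk⟩)) :
    Thm56Sub.EtaTautologicalGal (ofBiKummerData h toB Q odd_l R ιX hopen σ K' constEmb constEmb_injective hdivc hdivp)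
      P η := by
  rintro ⟨a, haHB⟩ ha
  obtain ⟨k, hk, rfl⟩ := hlift a haHB ha
  rw [hP k hk ha, ← RD.cocycle_lDeltaTheta η₀ hη₀ k hk]
  exact hη k

/-- (v2 record; abc-iut-w5-d123's `exists_eta_etaTautological_ofBiKummerData` VERBATIM.) **EtTh:Prop5.5/P55-L02, with the descent included**:
under `hdies` («the mod-`N` étale theta class dies on `Π_{B_N} ∩ Π^tp_Ÿ̲̲`», Prop. 5.2 (i)/(iii); GAP-LEDGER G-w5d123-1) and the row-2 laws
`hlift`, `hP` of the v2 subquotient datum, there IS an `η` on `H_{B_N}` descending `η₀` through `e` with `EtaTautologicalGal 𝔉 P η`.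
[cite: MochizukiEtTh2009, Prop 5.5 proof p.327 (PDF p.101)] -/
theorem exists_eta_etaTautological_ofBiKummerData_galois
    {η₀ : RD.PiYdd → RD.mu} (hη₀ : η₀ ∈ RD.thetaCocycles)
    (hdies : ∀ k : RD.PiYdd, rhoOfBiKummerData R ιX k = 1 → η₀ k = 1)
    (e : RD.mu → (ofBiKummerData h toB Q odd_l R ιX hopen σ K' constEmb constEmb_injective hdivc hdivp).lDeltaModN
      (ofBiKummerData h toB Q odd_l R ιX hopen σ K' constEmb constEmb_injective hdivc hdivp).BN)
    (P : ThetaSubquotientProjGalois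
      (ofBiKummerData h toB Q odd_l R ιX hopen σ K' constEmb constEmb_injective hdivc hdivp) Gal)
    (hlift : ∀ a ∈ (ofBiKummerData h toB Q odd_l R ιX hopen σ K' constEmb constEmb_injective hdivc hdivp).HB,
      a ∈ P.pre _ → ∃ k : RD.PiYdd, (k : RD.PiX) ∈ RD.lDeltaTheta ∧ rhoOfBiKummerData R ιX k = a)
    (hP : ∀ (k : RD.PiYdd) (hk : (k : RD.PiX) ∈ RD.lDeltaTheta) (hm : rhoOfBiKummerData R ιX k ∈ P.pre _),
      (QuotientGroup.mk (P.proj _ ⟨rhoOfBiKummerData R ιX k, hm⟩) :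
          (ofBiKummerData h toB Q odd_l R ιX hopen σ K' constEmb constEmb_injective hdivc hdivp).lDeltaModN
            (ofBiKummerData h toB Q odd_l R ιX hopen σ K' constEmb constEmb_injective hdivc hdivp).BN) =
        e (RD.thetaMod ⟨k, hk⟩)) :
    ∃ η : (ofBiKummerData h toB Q odd_l R ιX hopen σ K' constEmb constEmb_injective hdivc hdivp).HB →
        (ofBiKummerData h toB Q odd_l R ιX hopen σ K' constEmb constEmb_injective hdivc hdivp).lDeltaModN
          (ofBiKummerData h toB Q odd_l R ιX hopen σ K' constEmb constEmb_injective hdivc hdivp).BN,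
      (∀ k : RD.PiYdd, η ⟨rhoOfBiKummerData R ιX k, Subgroup.mem_map_of_mem _ k.2⟩ = e (η₀ k)) ∧
      Thm56Sub.EtaTautologicalGal (ofBiKummerData h toB Q odd_l R ιX hopen σ K' constEmb constEmb_injective hdivc hdivp)
        P η := by
  obtain ⟨η, hη⟩ := RD.toThetaEnvData.exists_descent_thetaCocycle (rhoOfBiKummerData R ιX) hη₀ hdies e
  exact ⟨η, hη, etaTautological_ofBiKummerData_galois h toB Q odd_l R ιX hopen σ K' constEmb constEmb_injective hdivc
    hdivp hη₀ e η hη P hlift hP⟩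

/-- (v2 record; abc-iut-w5-d123's `lDeltaCovered_ofBiKummerData` VERBATIM.) **`LDeltaCoveredGal` at the carrier** («`Δ_Θ` is a quotient of
`Π^tp_Ÿ`», §1 p.238 (PDF p.12)): for `𝔉 := ofBiKummerData …` and a v2 subquotient datum `P` with the row-2 laws `hpre`, `hP` and `e` onto,
EVERY element of `(l·Δ_Θ)_{B_N} ⊗ ℤ/Nℤ` is the class of `P.proj h` for some `h ∈ H_{B_N}` over `(l·Δ_Θ)_{B_N}`
(`RigidData.thetaMod_surjective`, `RigidData.lDeltaTheta_le`).  [cite: MochizukiEtTh2009, §1 p.238 (PDF p.12)] -/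
theorem lDeltaCovered_ofBiKummerData_galois
    (e : RD.mu → (ofBiKummerData h toB Q odd_l R ιX hopen σ K' constEmb constEmb_injective hdivc hdivp).lDeltaModN
      (ofBiKummerData h toB Q odd_l R ιX hopen σ K' constEmb constEmb_injective hdivc hdivp).BN)
    (he : Function.Surjective e)
    (P : ThetaSubquotientProjGalois
      (ofBiKummerData h toB Q odd_l R ιX hopen σ K' constEmb constEmb_injective hdivc hdivp) Gal)
    (hpre : ∀ k : RD.PiYdd, (k : RD.PiX) ∈ RD.lDeltaTheta → rhoOfBiKummerData R ιX k ∈ P.pre _)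
    (hP : ∀ (k : RD.PiYdd) (hk : (k : RD.PiX) ∈ RD.lDeltaTheta) (hm : rhoOfBiKummerData R ιX k ∈ P.pre _),
      (QuotientGroup.mk (P.proj _ ⟨rhoOfBiKummerData R ιX k, hm⟩) :
          (ofBiKummerData h toB Q odd_l R ιX hopen σ K' constEmb constEmb_injective hdivc hdivp).lDeltaModN
            (ofBiKummerData h toB Q odd_l R ιX hopen σ K' constEmb constEmb_injective hdivc hdivp).BN) =
        e (RD.thetaMod ⟨k, hk⟩)) :
    Thm56Sub.LDeltaCoveredGal (ofBiKummerData h toB Q odd_l R ιX hopen σ K' constEmb constEmb_injective hdivc hdivp)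
      P := by
  intro x
  obtain ⟨m, rfl⟩ := he x
  obtain ⟨g, rfl⟩ := RD.thetaMod_surjective m
  -- `g ∈ θ⁻¹(l·Δ_Θ) ⊆ Π^tp_Ÿ`
  have hgY : (g : RD.PiX) ∈ RD.PiYdd := (Subgroup.mem_inf.mp (RD.lDeltaTheta_le g.2)).1
  have hk : ((⟨(g : RD.PiX), hgY⟩ : RD.PiYdd) : RD.PiX) ∈ RD.lDeltaTheta := g.2
  refine ⟨⟨rhoOfBiKummerData R ιX (⟨(g : RD.PiX), hgY⟩ : RD.PiYdd), Subgroup.mem_map_of_mem _ hgY⟩,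
    hpre ⟨(g : RD.PiX), hgY⟩ hk, ?_⟩
  rw [hP ⟨(g : RD.PiX), hgY⟩ hk (hpre ⟨(g : RD.PiX), hgY⟩ hk)]

end EtaAndCoverage

section UnitsCentral

variable {K : Type u₀} [Field K]
  {X : SemiGraphs.TemperedArithmeticGroup.{u₀} K} {D₀ : Type u₀} [Category.{v₀} D₀]
  {V : FrdIMonoidStub.{w}} {T₀ : RealifiedDivisorMonoids (D₀ := D₀) V} {D : Type u} [Category.{v} D]
  {VD : FrdICatStub.{u, v, w} D} {S : BiKummerSetting X T₀ D VD}
  {pullFrac : ∀ {A A' : S.C} (_ : A' ⟶ A), S.biratUnits A → S.biratUnits A'}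
  {lv N : ℕ+} {T : ThetaEnvData.{max v w} N} {θ : S.biratUnits S.Aodot} {Bl : S.C}
  {Pl : S.FractionPair θ Bl} {Rl : S.NthRoot θ Pl lv pullFrac}
  (h : ModelFrobenioid.Hypotheses S.tf.divisorMonoid S.tf.ratFnFunctor)
  (toB : ∀ A : S.C, S.biratUnits A →* S.tf.biratUnitsModel A) (Q : FrobenioidTheta.ThetaSubquotientStub.{w} D)
  (odd_l : Odd (lv : ℕ)) (R : S.NthRoot Rl.root Rl.pair N pullFrac) (ιX : T.PiX ≃ₜ* X.Pi)
  (hopen : IsOpen ((S.galoisSurj R.AN.base R.αData.isGalois).ker : Set X.Pi)) (σ : Aut R.AN.base →* Aut R.AN)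
  (K' : Type w) [Field K'] (constEmb : K'ˣ →* S.tf.biratUnitsModel R.BN)
  (constEmb_injective : Function.Injective constEmb)
  (hdivc : ∀ g : Aut R.BN.base,
    ModelFrobenioid.div ((σ ((BiKummerSetting.NthRoot.baseIso S R).conjAut.symm g)).hom ≫ R.pair.num) =
      ModelFrobenioid.div R.pair.num)
  (hdivp : ∀ y : T.PiYdd,
    ModelFrobenioid.div ((σ (S.galoisSurj R.AN.base R.αData.isGalois (ιX y.1))).hom ≫ R.pair.den) =
      ModelFrobenioid.div R.pair.den)
  {Gal : D → Prop}

/-- (v2 record; abc-iut-w5-d020's `unitsCentralUnderLDelta_ofBiKummerData` VERBATIM.) **EtTh:Thm5.6(i)/T56-L09b at the assembled §5 data**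
(p.329 (PDF p.103) l.19–21): `UnitsCentralUnderLDeltaGal (ofBiKummerData …) P` — every lift `s^⊓-gp_N(g)`, `g` over `(l·Δ_Θ)_{B_N}`,
COMMUTES with `O^×(B_N)` — from `ModelFrobenioid.mul_units_comm_of_unit_fixed` and `(s^⊓-gp_N(g))^bs = g` (`sgpCapSection_ofBiKummerData`,
[FrdI] Prop. 5.6 via `hσ`), MODULO `hgeom` (the part `P.pre` over `(l·Δ_Θ)_{B_N}` is geometric, §1 p.238 (PDF p.12)) and `hconst`
(geometric automorphisms fix the unit components, [EtTh] Prop. 3.4 (ii) / Ex. 3.9; GAP-LEDGER G-w5d020-1).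
[cite: MochizukiEtTh2009, Thm 5.6 proof p.329 (PDF p.103); §1 p.238 (PDF p.12)] -/
theorem unitsCentralUnderLDelta_ofBiKummerData_galois
    (hσ : ∀ g : Aut R.AN.base, ModelFrobenioid.baseMap (σ g).hom = g.hom)
    (P : ThetaSubquotientProjGalois
      (ofBiKummerData h toB Q odd_l R ιX hopen σ K' constEmb constEmb_injective hdivc hdivp) Gal)
    (hgeom : P.pre R.BN.base ≤ T.aug.ker.map (rhoOfBiKummerData R ιX))
    (hconst : ∀ δ ∈ T.aug.ker, ∀ τ : ModelFrobenioid.units R.BN,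
      (S.tf.ratFnFunctor.map (rhoOfBiKummerData R ιX δ).hom.op).hom (ModelFrobenioid.unit τ.1.hom) =
        ModelFrobenioid.unit τ.1.hom) :
    Thm56Sub.UnitsCentralUnderLDeltaGal
      (ofBiKummerData h toB Q odd_l R ιX hopen σ K' constEmb constEmb_injective hdivc hdivp) P := by
  intro g hg u hu
  -- `g = ρ(δ)` for a geometric `δ`
  obtain ⟨δ, hδ, rfl⟩ := hgeom hg
  -- the lift lies over `g`: `Base(s^⊓-gp_N(g)) = g`, hence `Base(s^⊓-gp_N(g)⁻¹) = g⁻¹ = ρ(δ⁻¹)`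
  have hsec := sgpCapSection_ofBiKummerData h toB Q odd_l R ιX hopen σ K' constEmb constEmb_injective hdivc hdivp hσ
    (rhoOfBiKummerData R ιX δ)
  have hinv : ModelFrobenioid.baseMap
      ((ofBiKummerData h toB Q odd_l R ιX hopen σ K' constEmb constEmb_injective hdivc hdivp).sgpCap
        (rhoOfBiKummerData R ιX δ)).inv = (rhoOfBiKummerData R ιX δ⁻¹).hom := by
    rw [map_inv]
    exact congrArg Iso.inv hsec
  -- the unit as a unit of the model Frobenioid
  have hu' : u ∈ ModelFrobenioid.units R.BN := hu
  have key := ModelFrobenioid.mul_units_comm_of_unit_fixed (S.isIntegral_of_hypotheses h (op R.BN.base))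
    ((ofBiKummerData h toB Q odd_l R ιX hopen σ K' constEmb constEmb_injective hdivc hdivp).sgpCap
      (rhoOfBiKummerData R ιX δ)) ⟨u, hu'⟩ (by
        rw [hinv]
        exact hconst δ⁻¹ (T.aug.ker.inv_mem hδ) ⟨u, hu'⟩)
  exact key

/-- (v2 record; abc-iut-w5-d020's `cyclotomeCentralUnderLDelta_ofBiKummerData` VERBATIM.) **P55-L02b at the assembled data**: the lifts
over `(l·Δ_Θ)_{B_N}` commute with `μ_N(B_N) ⊆ O^×(B_N)` (v2 `CyclotomeCentralUnderLDeltaGal`).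
[cite: MochizukiEtTh2009, Prop 5.5 proof p.327 (PDF p.101)] -/
theorem cyclotomeCentralUnderLDelta_ofBiKummerData_galois
    (hσ : ∀ g : Aut R.AN.base, ModelFrobenioid.baseMap (σ g).hom = g.hom)
    (P : ThetaSubquotientProjGalois
      (ofBiKummerData h toB Q odd_l R ιX hopen σ K' constEmb constEmb_injective hdivc hdivp) Gal)
    (hgeom : P.pre R.BN.base ≤ T.aug.ker.map (rhoOfBiKummerData R ιX))
    (hconst : ∀ δ ∈ T.aug.ker, ∀ τ : ModelFrobenioid.units R.BN,
      (S.tf.ratFnFunctor.map (rhoOfBiKummerData R ιX δ).hom.op).hom (ModelFrobenioid.unit τ.1.hom) =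
        ModelFrobenioid.unit τ.1.hom) :
    Thm56Sub.CyclotomeCentralUnderLDeltaGal
      (ofBiKummerData h toB Q odd_l R ιX hopen σ K' constEmb constEmb_injective hdivc hdivp) P :=
  Thm56Sub.cyclotomeCentral_of_unitsCentral_gal _
    (unitsCentralUnderLDelta_ofBiKummerData_galois h toB Q odd_l R ιX hopen σ K' constEmb constEmb_injective hdivc hdivp
      hσ P hgeom hconst)

end UnitsCentral

/-! ### T56-L09c `DeltaTransportCompatGal` (this lineage's `Sec5DeltaTransportCompat`) on the v2 record -/

namespace Thm56Sub

section AbstractCompat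

universe u' v'

variable {C : Type u} [Category.{v} C] {D : Type u'} [Category.{v'} D] (𝔉 : ThetaFrobenioid.{w} C D) {Gal : D → Prop}

/-- (v2 record; `Thm56Sub.deltaTransportCompat_of` VERBATIM.) **EtTh:Thm5.6(i)/T56-L09c DERIVED from T56-L02 + Props. 2.4/2.6 + the
row-2 laws** (p.329 (PDF p.103) l.1, l.17–21; p.327 (PDF p.101)): for a subgroup `L ⊆ Π^tp_X` (printed: `θ⁻¹(l·Δ_Θ)`) with a reduction
`tm : L → M` and `e : M → (l·Δ_Θ)_{B_N} ⊗ ℤ/Nℤ`, and `γ : Π^tp_X → Π^tp_X` (induced by `Ψ^bs`): IF `θ ∘ ρ = ρ ∘ γ` on `L` (`hγ`), `γ(L) ⊆ L`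
(`hγL`), `aΨ_{B_N}` read through `β` and `e` is induced by `γ` (`haΨ`), and the v2 datum `P` at `B_N^bs` is the image of `L` under `ρ` with
`proj ∘ ρ = e ∘ tm` (`hcov`, `hpre`, `hP`), THEN `DeltaTransportCompatGal 𝔉 Ψ β aΨ θ P`.  [cite: MochizukiEtTh2009, Thm 5.6 proof p.329 (PDF p.103)] -/
theorem deltaTransportCompat_of_galois (Ψ : C ≌ C) (β : Ψ.functor.obj 𝔉.BN ≅ 𝔉.BN)
    (aΨ : ∀ S : C, 𝔉.lDeltaModN S ≃* 𝔉.lDeltaModN (Ψ.functor.obj S))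
    (θ : Aut (𝔉.base.obj 𝔉.BN) ≃* Aut (𝔉.base.obj 𝔉.BN)) (P : ThetaSubquotientProjGalois 𝔉 Gal)
    (L : Subgroup 𝔉.PiX) {M : Type*} (tm : L → M) (e : M → 𝔉.lDeltaModN 𝔉.BN) (γ : 𝔉.PiX → 𝔉.PiX)
    (hγ : ∀ k : 𝔉.PiX, k ∈ L → θ (𝔉.ρ k) = 𝔉.ρ (γ k))
    (hγL : ∀ k : 𝔉.PiX, k ∈ L → γ k ∈ L)
    (haΨ : ∀ (k : 𝔉.PiX) (hk : k ∈ L),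
      𝔉.lDeltaModNMap β.hom (aΨ 𝔉.BN (e (tm ⟨k, hk⟩))) = e (tm ⟨γ k, hγL k hk⟩))
    (hcov : ∀ g ∈ P.pre (𝔉.base.obj 𝔉.BN), ∃ k ∈ L, 𝔉.ρ k = g)
    (hpre : ∀ k : 𝔉.PiX, k ∈ L → 𝔉.ρ k ∈ P.pre (𝔉.base.obj 𝔉.BN))
    (hP : ∀ (k : 𝔉.PiX) (hk : k ∈ L) (hm : 𝔉.ρ k ∈ P.pre (𝔉.base.obj 𝔉.BN)),
      (QuotientGroup.mk (P.proj _ ⟨𝔉.ρ k, hm⟩) : 𝔉.lDeltaModN 𝔉.BN) = e (tm ⟨k, hk⟩)) :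
    DeltaTransportCompatGal 𝔉 Ψ β aΨ θ P := by
  intro g hg
  obtain ⟨k, hk, rfl⟩ := hcov g hg
  have hmem : θ (𝔉.ρ k) ∈ P.pre (𝔉.base.obj 𝔉.BN) := by
    rw [hγ k hk]
    exact hpre _ (hγL k hk)
  refine ⟨hmem, ?_⟩
  rw [hP k hk hg, haΨ k hk]
  have hsub : (⟨θ (𝔉.ρ k), hmem⟩ : P.pre (𝔉.base.obj 𝔉.BN)) = ⟨𝔉.ρ (γ k), hpre _ (hγL k hk)⟩ :=
    Subtype.ext (hγ k hk)
  rw [hsub, hP (γ k) (hγL k hk)]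

/-- (v2 record; `Thm56Sub.pre_stable_of` VERBATIM.) **T56-L09c, the membership clause alone** (p.329 l.1 «`Ψ` preserves "`(l·Δ_Θ)_{(−)}`"» at
`B_N^bs`): under `hγ`, `hγL` and the row-2 image laws (`hcov`, `hpre`) of the v2 datum, the base transport `θ` stabilises `P.pre(B_N^bs)`.
[cite: MochizukiEtTh2009, Thm 5.6 proof p.329 (PDF p.103)] -/
theorem pre_stable_of_galois (θ : Aut (𝔉.base.obj 𝔉.BN) ≃* Aut (𝔉.base.obj 𝔉.BN)) (P : ThetaSubquotientProjGalois 𝔉 Gal)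
    (L : Subgroup 𝔉.PiX) (γ : 𝔉.PiX → 𝔉.PiX)
    (hγ : ∀ k : 𝔉.PiX, k ∈ L → θ (𝔉.ρ k) = 𝔉.ρ (γ k)) (hγL : ∀ k : 𝔉.PiX, k ∈ L → γ k ∈ L)
    (hcov : ∀ g ∈ P.pre (𝔉.base.obj 𝔉.BN), ∃ k ∈ L, 𝔉.ρ k = g)
    (hpre : ∀ k : 𝔉.PiX, k ∈ L → 𝔉.ρ k ∈ P.pre (𝔉.base.obj 𝔉.BN))
    (g : Aut (𝔉.base.obj 𝔉.BN)) (hg : g ∈ P.pre (𝔉.base.obj 𝔉.BN)) :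
    θ g ∈ P.pre (𝔉.base.obj 𝔉.BN) := by
  obtain ⟨k, hk, rfl⟩ := hcov g hg
  rw [hγ k hk]
  exact hpre _ (hγL k hk)

end AbstractCompat

section GenuineCompat

variable {K : Type u₀} [Field K]
  {X : SemiGraphs.TemperedArithmeticGroup.{u₀} K} {D₀ : Type u₀} [Category.{v₀} D₀]
  {V : FrdIMonoidStub.{w}} {T₀ : RealifiedDivisorMonoids (D₀ := D₀) V} {D : Type u} [Category.{v} D]
  {VD : FrdICatStub.{u, v, w} D} {S : BiKummerSetting X T₀ D VD}
  {pullFrac : ∀ {A A' : S.C} (_ : A' ⟶ A), S.biratUnits A → S.biratUnits A'}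
  {lv N : ℕ+} {l' : ℕ} {RD : RigidData.{max v w} N l'} {θ : S.biratUnits S.Aodot} {Bl : S.C}
  {Pl : S.FractionPair θ Bl} {Rl : S.NthRoot θ Pl lv pullFrac}
  (h : ModelFrobenioid.Hypotheses S.tf.divisorMonoid S.tf.ratFnFunctor)
  (toB : ∀ A : S.C, S.biratUnits A →* S.tf.biratUnitsModel A) (Q : FrobenioidTheta.ThetaSubquotientStub.{w} D)
  (odd_l : Odd (lv : ℕ)) (R : S.NthRoot Rl.root Rl.pair N pullFrac) (ιX : RD.PiX ≃ₜ* X.Pi)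
  (hopen : IsOpen ((S.galoisSurj R.AN.base R.αData.isGalois).ker : Set X.Pi)) (σ : Aut R.AN.base →* Aut R.AN)
  (K' : Type w) [Field K'] (constEmb : K'ˣ →* S.tf.biratUnitsModel R.BN)
  (constEmb_injective : Function.Injective constEmb)
  (hdivc : ∀ g : Aut R.BN.base,
    ModelFrobenioid.div ((σ ((BiKummerSetting.NthRoot.baseIso S R).conjAut.symm g)).hom ≫ R.pair.num) =
      ModelFrobenioid.div R.pair.num)
  (hdivp : ∀ y : RD.PiYdd,
    ModelFrobenioid.div ((σ (S.galoisSurj R.AN.base R.αData.isGalois (ιX y.1))).hom ≫ R.pair.den) =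
      ModelFrobenioid.div R.pair.den)
  {Gal : D → Prop}

/-- (v2 record; `Thm56Sub.deltaTransportCompat_ofBiKummerData` VERBATIM.) **EtTh:Thm5.6(i)/T56-L09c AT THE GENUINE §5 DATA**
(`𝔉 := ofBiKummerData …`, `ρ = rhoOfBiKummerData R ιX`): for a continuous automorphism `γ` of `Π^tp_X` with `θ ∘ ρ = ρ ∘ γ` (`hγ`: T56-L02,
[SemiAnbd] Prop. 3.2), stabilising `θ⁻¹(l·Δ_Θ)` (`hγL`: Props. 2.4/2.6), with `aΨ` at `B_N` induced by `γ` on `(l·Δ_Θ) ⊗ ℤ/Nℤ` (`haΨ`: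
T56-L03), and the row-2 laws `hpre`/`hP` plus the image law `hcov` of the v2 datum `P`, `DeltaTransportCompatGal` HOLDS.
[cite: MochizukiEtTh2009, Thm 5.6 proof p.329 (PDF p.103)] -/
theorem deltaTransportCompat_ofBiKummerData_galois
    (e : RD.mu → (ofBiKummerData h toB Q odd_l R ιX hopen σ K' constEmb constEmb_injective hdivc hdivp).lDeltaModN
      (ofBiKummerData h toB Q odd_l R ιX hopen σ K' constEmb constEmb_injective hdivc hdivp).BN)
    (P : ThetaSubquotientProjGalois
      (ofBiKummerData h toB Q odd_l R ιX hopen σ K' constEmb constEmb_injective hdivc hdivp) Gal)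
    (hpre : ∀ k : RD.PiYdd, (k : RD.PiX) ∈ RD.lDeltaTheta → rhoOfBiKummerData R ιX k ∈ P.pre _)
    (hP : ∀ (k : RD.PiYdd) (hk : (k : RD.PiX) ∈ RD.lDeltaTheta) (hm : rhoOfBiKummerData R ιX k ∈ P.pre _),
      (QuotientGroup.mk (P.proj _ ⟨rhoOfBiKummerData R ιX k, hm⟩) :
          (ofBiKummerData h toB Q odd_l R ιX hopen σ K' constEmb constEmb_injective hdivc hdivp).lDeltaModN
            (ofBiKummerData h toB Q odd_l R ιX hopen σ K' constEmb constEmb_injective hdivc hdivp).BN) =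
        e (RD.thetaMod ⟨k, hk⟩))
    (hcov : ∀ g ∈ P.pre ((ofBiKummerData h toB Q odd_l R ιX hopen σ K' constEmb constEmb_injective hdivc hdivp).base.obj
        (ofBiKummerData h toB Q odd_l R ιX hopen σ K' constEmb constEmb_injective hdivc hdivp).BN),
      ∃ k : RD.PiYdd, (k : RD.PiX) ∈ RD.lDeltaTheta ∧ rhoOfBiKummerData R ιX k = g)
    (Ψ : S.C ≌ S.C)
    (β : Ψ.functor.obj (ofBiKummerData h toB Q odd_l R ιX hopen σ K' constEmb constEmb_injective hdivc hdivp).BN ≅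
      (ofBiKummerData h toB Q odd_l R ιX hopen σ K' constEmb constEmb_injective hdivc hdivp).BN)
    (aΨ : ∀ A : S.C,
      (ofBiKummerData h toB Q odd_l R ιX hopen σ K' constEmb constEmb_injective hdivc hdivp).lDeltaModN A ≃*
        (ofBiKummerData h toB Q odd_l R ιX hopen σ K' constEmb constEmb_injective hdivc hdivp).lDeltaModN
          (Ψ.functor.obj A))
    (θΨ : Aut R.BN.base ≃* Aut R.BN.base) (γ : RD.PiX ≃ₜ* RD.PiX)
    (hγ : ∀ y : RD.PiX, θΨ (rhoOfBiKummerData R ιX y) = rhoOfBiKummerData R ιX (γ y))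
    (hγL : RD.lDeltaTheta.map γ.toMulEquiv.toMonoidHom = RD.lDeltaTheta)
    (haΨ : ∀ (k : RD.PiYdd) (hk : (k : RD.PiX) ∈ RD.lDeltaTheta) (hk' : γ k ∈ RD.lDeltaTheta),
      (ofBiKummerData h toB Q odd_l R ιX hopen σ K' constEmb constEmb_injective hdivc hdivp).lDeltaModNMap β.hom
          (aΨ _ (e (RD.thetaMod ⟨k, hk⟩))) = e (RD.thetaMod ⟨γ k, hk'⟩)) :
    DeltaTransportCompatGal (ofBiKummerData h toB Q odd_l R ιX hopen σ K' constEmb constEmb_injective hdivc hdivp)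
      Ψ β aΨ θΨ P := by
  -- membership in `θ⁻¹(l·Δ_Θ)` forces membership in `Π^tp_Ÿ` (Prop. 2.14 (i): `(l·Δ_Θ) ⊆ (Δ^tp_Ÿ)^Θ`)
  have hY : ∀ k : RD.PiX, k ∈ RD.lDeltaTheta → k ∈ RD.PiYdd := fun k hk =>
    (Subgroup.mem_inf.mp (RD.lDeltaTheta_le hk)).1
  have hγL' : ∀ k : RD.PiX, k ∈ RD.lDeltaTheta → γ k ∈ RD.lDeltaTheta := by
    intro k hk
    rw [← hγL]
    exact Subgroup.mem_map.mpr ⟨k, hk, rfl⟩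
  refine deltaTransportCompat_of_galois _ Ψ β aΨ θΨ P RD.lDeltaTheta (fun k => RD.thetaMod k) e γ
    (fun k _ => hγ k) hγL' ?_ ?_ ?_ ?_
  · intro k hk
    exact haΨ ⟨k, hY k hk⟩ hk (hγL' k hk)
  · intro g hg
    obtain ⟨k, hk, hkg⟩ := hcov g hg
    exact ⟨(k : RD.PiX), hk, hkg⟩
  · intro k hk
    exact hpre ⟨k, hY k hk⟩ hk
  · intro k hk hm
    exact hP ⟨k, hY k hk⟩ hk hm

end GenuineCompat

end Thm56Sub

end ThetaFrobenioid

end Literature.AnabelianGeometry.EtaleTheta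

end
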